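import Summits.Ventures.PackingBounds.Energy.TenPointCkFourUnique
import Summits.Ventures.PackingBounds.Energy.TenPointCkFourOptimal
import Summits.Ventures.PackingBounds.Configurations.OrthogonalPentagonsEnergy
import HarnessLib

/-!
# Ten points on `S³`, potential `(1+⟪x,y⟫)^4`: the ground state is two orthogonal regular pentagons (unique up to isometry)

Framing: lottery ticket; floor = certified bounds/negative ranges. Venture `PackingBounds`, cell
`pub-packcert`, energy family E3PT (pub-packcert-energy gen 14; n = 4 kernel route = KERNEL-D6 data route + `threePointF 4`).

Assembly of `TenPointCkFour.ck4_ten_points_rigid` (a minimiser has all inner products in `{0, (√5-1)/4, -(√5+1)/4}`) and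
`TenPointCkFour.ck4_ten_points_balanced` (`Σ x = 0`) with the classification `Config.OrthogonalPentagonsUnique.isometric` of ten-point
`{0, cos 72°, cos 144°}`-codes of `ℝ⁴` with vanishing Gram row sums (two regular pentagons in orthogonal planes): any two minimisers are
isometric, and every minimiser is an isometric image of the explicit configuration of `TenPointCkFour.pentagons_ck4_energy`.
-/

noncomputable section

open Finset
open scoped RealInnerProductSpace

namespace Summit.Ventures.PackingBounds.Energy.TenPointCkFour

open Summit.Ventures.PackingBounds.Config

/-- A minimiser of the `(1+t)^4`-energy of ten points on `S³` is a ten-point `{0, cos 72°, cos 144°}`-code with vanishing Gram row sums. -/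
theorem isCode_of_minW4 (C : Finset (EuclideanSpace ℝ (Fin 4))) (hC : ∀ x ∈ C, ‖x‖ = 1) (h10 : C.card = 10)
    (hmin : ∑ x ∈ C, ∑ y ∈ C.erase x, (1 + inner ℝ x y) ^ 4 = ((435 : ℝ)/4)) :
    OrthogonalPentagonsUnique.IsCode C :=
  OrthogonalPentagonsUnique.isCode_of hC (ck4_ten_points_rigid C hC h10 hmin) (ck4_ten_points_balanced C hC h10 hmin)

/-- **`(1+t)^4`-energy of ten points on `S³`, uniqueness:** any two minimisers (`Σ_{x≠y} (1+⟪x,y⟫)^4 = 435/4`) are related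
by a linear isometry of `ℝ⁴` (both are two orthogonal regular pentagons). -/
theorem minimisers_isometric (C C' : Finset (EuclideanSpace ℝ (Fin 4)))
    (hC : ∀ x ∈ C, ‖x‖ = 1) (h10 : C.card = 10)
    (hmin : ∑ x ∈ C, ∑ y ∈ C.erase x, (1 + inner ℝ x y) ^ 4 = ((435 : ℝ)/4))
    (hC' : ∀ x ∈ C', ‖x‖ = 1) (h10' : C'.card = 10)
    (hmin' : ∑ x ∈ C', ∑ y ∈ C'.erase x, (1 + inner ℝ x y) ^ 4 = ((435 : ℝ)/4)) :
    ∃ Ψ : EuclideanSpace ℝ (Fin 4) ≃ₗᵢ[ℝ] EuclideanSpace ℝ (Fin 4), C' = C.image Ψ :=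
  OrthogonalPentagonsUnique.isometric (isCode_of_minW4 C hC h10 hmin) h10 (isCode_of_minW4 C' hC' h10' hmin') h10'

/-- **Ground state unique up to isometry:** there is a minimising configuration (two orthogonal regular pentagons) of which every
minimiser of `Σ_{x≠y} (1+⟪x,y⟫)^4` over ten unit vectors of `ℝ⁴` is an isometric image. -/
theorem ground_state_unique : ∃ C₀ : Finset (EuclideanSpace ℝ (Fin 4)), C₀.card = 10 ∧ (∀ x ∈ C₀, ‖x‖ = 1) ∧
    ∑ x ∈ C₀, ∑ y ∈ C₀.erase x, (1 + inner ℝ x y) ^ 4 = ((435 : ℝ)/4) ∧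
    ∀ C : Finset (EuclideanSpace ℝ (Fin 4)), (∀ x ∈ C, ‖x‖ = 1) → C.card = 10 →
      ∑ x ∈ C, ∑ y ∈ C.erase x, (1 + inner ℝ x y) ^ 4 = ((435 : ℝ)/4) →
      ∃ Ψ : EuclideanSpace ℝ (Fin 4) ≃ₗᵢ[ℝ] EuclideanSpace ℝ (Fin 4), C = C₀.image Ψ := by
  obtain ⟨C₀, hc0, hn0, he0⟩ := pentagons_ck4_energy
  exact ⟨C₀, hc0, hn0, he0, fun C hC h10 hmin => minimisers_isometric C₀ C hn0 hc0 he0 hC h10 hmin⟩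

/-- **Ground-state energy for every pair potential:** a minimiser of the `(1+t)^4`-energy of ten points on `S³` has
`Σ_{x≠y} a(⟪x,y⟫) = 10·(2a(cos 144°) + 2a(cos 72°) + 5a(0))` — the distance distribution of two orthogonal regular pentagons. -/
theorem ground_state_energy (C : Finset (EuclideanSpace ℝ (Fin 4))) (hC : ∀ x ∈ C, ‖x‖ = 1) (h10 : C.card = 10)
    (hmin : ∑ x ∈ C, ∑ y ∈ C.erase x, (1 + inner ℝ x y) ^ 4 = ((435 : ℝ)/4)) (a : ℝ → ℝ) :
    ∑ x ∈ C, ∑ y ∈ C.erase x, a (inner ℝ x y)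
      = (10 : ℝ) * (2 * a ((-1 - Real.sqrt 5) / 4) + 2 * a ((-1 + Real.sqrt 5) / 4) + 5 * a 0) :=
  OrthogonalPentagonsUnique.energy_eq (isCode_of_minW4 C hC h10 hmin) h10 a

end Summit.Ventures.PackingBounds.Energy.TenPointCkFour
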